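import Mathlib
import Summits.PneNP.PneNP.Theorems.RamseyUncertifiableRegularResolutionRungDefs

/-!
# Prömel–Rödl bi-dense core from Erdős–Szemerédi (stub `stub_ramseyBiDenseCore`)

Crux `stmt-PneNP-9818` (`Summit.PneNP.PneNP.Theses.RamseyUncertifiable.RegularResolutionRung`), line
`sound-path-bottleneck`.  Prömel–Rödl 1999 (JCTA 88, 379–384; quoted as Lauria–Pudlák–Rödl–Thapen,
arXiv:1303.3166, Lemma 11) in two-sided re-indexed form, derived from the Erdős–Szemerédi theorem (the
hypothesis) by the Bukh–Sudakov / Kwan–Sudakov (arXiv:1711.02937, Lemma 4) extraction at polynomial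
scale.  Constants: `ε` = the Erdős–Szemerédi constant at `C = 5` capped at `1`, `L = ⌈2/ε⌉`, `δ = ε/16`,
`β = 1/(32L)`, `s = ⌈√n⌉`.  `iterate` runs `2L` levels of a recursion on states `(U, P, Q, a, b)`:
`|U| ≥ n^{1-2iβ}` at level `i = a + b`; `P` (resp. `Q`) is the disjoint union of `a` (resp. `b`)
extracted `s`-sets, every vertex of `U` has `≤ 4δ|P|` neighbours in `P` and `≤ 4δ|Q|` non-neighbours
in `Q`, and `e_G(P,P) ≤ (a + 4δa²)s²`, `e_{Gᶜ}(Q,Q) ≤ (b + 4δb²)s²`.  If `U` is two-sided bi-dense at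
scale `⌈|U|^{1-β}⌉` we stop (`core_of_good` re-indexes `U` as `Fin |U|` along `Finset.orderEmbOfFin`);
otherwise a bad pair `A, B ⊆ U` is `δ`-sparse in `Γ ∈ {G, Gᶜ}` and `step` (two Markov inequalities)
extracts an `s`-set `S ⊆ A` and `U' ⊆ B ∖ S`, `|U'| ≥ |B|/2 - s ≥ n^{1-2(i+1)β}` (`sizes`), all of whose
vertices have `≤ 4δs` neighbours in `S`.  At level `2L` one of `a, b` is `≥ L ≥ 2/ε`, so
`e_Γ(P,P) < ε|P|²` with `|P| ≥ √n` and `⌈log₂ n²⌉ ≤ 5 log₂ |P|`, contradicting Erdős–Szemerédi for the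
induced graph `Γ.comap e_P`, which inherits both clique-freeness conditions (`absurd_of_family`).
-/

set_option linter.dupNamespace false -- `Summit.PneNP.PneNP`: single-conjunct summit

namespace Summit.PneNP.PneNP.Cruxes.RegularResolutionRung.SoundPathBottleneck

namespace BiDenseCore

variable {n : ℕ}

/-- `e(A,B) = e(B,A)`. -/
theorem edgeCount_comm (Γ : SimpleGraph (Fin n)) [DecidableRel Γ.Adj] (A B : Finset (Fin n)) :
    edgeCount Γ A B = edgeCount Γ B A := by
  have := Γ.symm
  exact Rel.card_interedges_comm A B

/-- Additivity of `e(·, X)` over a disjoint union. -/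
theorem edgeCount_union_left (Γ : SimpleGraph (Fin n)) [DecidableRel Γ.Adj] {P S : Finset (Fin n)}
    (h : Disjoint P S) (X : Finset (Fin n)) :
    edgeCount Γ (P ∪ S) X = edgeCount Γ P X + edgeCount Γ S X := by
  rw [edgeCount_eq_sum, edgeCount_eq_sum, edgeCount_eq_sum, Finset.sum_union h]

/-- Additivity of `e(X, ·)` over a disjoint union. -/
theorem edgeCount_union_right (Γ : SimpleGraph (Fin n)) [DecidableRel Γ.Adj] (X : Finset (Fin n))
    {P S : Finset (Fin n)} (h : Disjoint P S) :
    edgeCount Γ X (P ∪ S) = edgeCount Γ X P + edgeCount Γ X S := by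
  rw [edgeCount_comm, edgeCount_union_left Γ h, edgeCount_comm Γ P, edgeCount_comm Γ S]

/-- `e_G(A,B) + e_{Gᶜ}(A,B) ≤ |A||B|` (the diagonal of `A ∩ B` is counted by neither). -/
theorem edgeCount_add_compl_le (G : SimpleGraph (Fin n)) [DecidableRel G.Adj] (A B : Finset (Fin n)) :
    edgeCount G A B + edgeCount Gᶜ A B ≤ A.card * B.card := by
  unfold edgeCount
  rw [← Finset.card_product, ← Finset.card_union_of_disjoint]
  · exact Finset.card_le_card
      (Finset.union_subset (Finset.filter_subset _ _) (Finset.filter_subset _ _))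
  · exact Finset.disjoint_filter.2 fun p _ h1 h2 => ((SimpleGraph.compl_adj _ _ _).1 h2).2 h1

/-- Transport along an embedding: `e_{G.comap e}(A,B) = e_G(e(A), e(B))`. -/
theorem edgeCount_comap {m : ℕ} (G : SimpleGraph (Fin n)) [DecidableRel G.Adj] (e : Fin m ↪ Fin n)
    (A B : Finset (Fin m)) : edgeCount (G.comap e) A B = edgeCount G (A.map e) (B.map e) := by
  unfold edgeCount
  rw [← Finset.card_map (e.prodMap e)]
  congr 1
  ext ⟨x, y⟩
  simp only [Finset.mem_map, Finset.mem_filter, Finset.mem_product, Function.Embedding.coe_prodMap,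
    Prod.exists, Prod.map_apply, Prod.mk.injEq, SimpleGraph.comap_adj]
  constructor
  · rintro ⟨a, b, ⟨⟨ha, hb⟩, h⟩, rfl, rfl⟩
    exact ⟨⟨⟨a, ha, rfl⟩, ⟨b, hb, rfl⟩⟩, h⟩
  · rintro ⟨⟨⟨a, ha, rfl⟩, ⟨b, hb, rfl⟩⟩, h⟩
    exact ⟨a, b, ⟨⟨ha, hb⟩, h⟩, rfl, rfl⟩

/-- The increasing enumeration of `U` carries subsets of `Fin |U|` into `U`, and `univ` onto `U`. -/
theorem map_orderEmbOfFin (U : Finset (Fin n)) (A : Finset (Fin U.card)) :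
    A.map (U.orderEmbOfFin rfl).toEmbedding ⊆ U ∧
      (Finset.univ : Finset (Fin U.card)).map (U.orderEmbOfFin rfl).toEmbedding = U := by
  have h : ∀ C : Finset (Fin U.card), C.map (U.orderEmbOfFin rfl).toEmbedding ⊆ U := by
    intro C x hx
    obtain ⟨i, -, rfl⟩ := Finset.mem_map.1 hx
    exact U.orderEmbOfFin_mem rfl i
  exact ⟨h A, Finset.eq_of_subset_of_card_le (h _) (by simp)⟩

/-- Markov's inequality on a finset: if `Σ_{v ∈ A} f(v) ≤ t|A|/2` with `f ≥ 0` and `t > 0`, then at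
least half of the elements of `A` satisfy `f ≤ t`. -/
theorem card_le_two_mul_card_filter {α : Type*} (A : Finset α) (f : α → ℝ) {t : ℝ} (ht : 0 < t)
    (hf : ∀ v ∈ A, 0 ≤ f v) (hsum : ∑ v ∈ A, f v ≤ t * A.card / 2) :
    (A.card : ℝ) ≤ 2 * ((A.filter fun v => f v ≤ t).card : ℝ) := by
  have h1 : ((A.filter fun v => ¬ f v ≤ t).card : ℝ) * t ≤
      ∑ v ∈ A.filter (fun v => ¬ f v ≤ t), f v := by
    rw [← nsmul_eq_mul]
    exact Finset.card_nsmul_le_sum _ _ _ fun v hv => (not_le.1 (Finset.mem_filter.1 hv).2).le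
  have h2 : ∑ v ∈ A.filter (fun v => ¬ f v ≤ t), f v ≤ ∑ v ∈ A, f v :=
    Finset.sum_le_sum_of_subset_of_nonneg (Finset.filter_subset _ _) fun v hv _ => hf v hv
  have h3 : ((A.filter fun v => f v ≤ t).card : ℝ) + ((A.filter fun v => ¬ f v ≤ t).card : ℝ) =
      A.card := by
    exact_mod_cast Finset.card_filter_add_card_filter_not (s := A) (fun v => f v ≤ t)
  have h4 : ((A.filter fun v => ¬ f v ≤ t).card : ℝ) * t ≤ (A.card / 2) * t := by linarith
  linarith [le_of_mul_le_mul_right h4 ht]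

/-- **One extraction step** in `Γ` (sparse form): from `A, B ⊆ U` with `e_Γ(A,B) < δ|A||B|`,
`|A| ≥ 2s`, `B ≠ ∅`, two Markov inequalities give an `s`-set `S ⊆ A` and `U' ⊆ B ∖ S`,
`|U'| ≥ |B|/2 - s`, whose vertices have `≤ 4δs` neighbours in `S`; the union `P` of the `a` earlier
`s`-sets (disjoint from `U`; every vertex of `U` has `≤ 4δas` neighbours in `P`;
`e_Γ(P,P) ≤ (a + 4δa²)s²`) becomes `P ∪ S`. -/
theorem step (Γ : SimpleGraph (Fin n)) [DecidableRel Γ.Adj] {δ : ℝ} (hδ : 0 < δ) {s a : ℕ}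
    (hs : 0 < s) {U P A B : Finset (Fin n)} (hPU : Disjoint P U) (hPcard : P.card = a * s)
    (hdeg : ∀ u ∈ U, ((P.filter fun b => Γ.Adj u b).card : ℝ) ≤ 4 * δ * a * s)
    (hPP : (edgeCount Γ P P : ℝ) ≤ (a + 4 * δ * a ^ 2) * s ^ 2)
    (hAU : A ⊆ U) (hBU : B ⊆ U) (hA : 2 * s ≤ A.card) (hB : 0 < B.card)
    (hbad : (edgeCount Γ A B : ℝ) < δ * A.card * B.card) :
    ∃ U' P' : Finset (Fin n), U' ⊆ U ∧ Disjoint P' U' ∧ P'.card = (a + 1) * s ∧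
      (∀ u ∈ U', ((P'.filter fun b => Γ.Adj u b).card : ℝ) ≤ 4 * δ * ((a + 1 : ℕ) : ℝ) * s) ∧
      (edgeCount Γ P' P' : ℝ) ≤ (((a + 1 : ℕ) : ℝ) + 4 * δ * ((a + 1 : ℕ) : ℝ) ^ 2) * s ^ 2 ∧
      (B.card : ℝ) / 2 - s ≤ U'.card := by
  have hB' : (0 : ℝ) < B.card := by exact_mod_cast hB
  have hs' : (0 : ℝ) < s := by exact_mod_cast hs
  -- Markov 1: the vertices of `A` with `≤ 2δ|B|` neighbours in `B` are at least `|A|/2 ≥ s`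
  set A'' := A.filter fun a => ((B.filter fun b => Γ.Adj a b).card : ℝ) ≤ 2 * δ * B.card with hA''
  have hM1 : (A.card : ℝ) ≤ 2 * A''.card := by
    refine card_le_two_mul_card_filter A _ (by positivity) (fun v _ => by positivity) ?_
    rw [edgeCount_eq_sum] at hbad
    push_cast at hbad
    linarith
  obtain ⟨S, hSA'', hScard⟩ : ∃ S ⊆ A'', S.card = s := Finset.exists_subset_card_eq (by
    have h1 : ((2 * s : ℕ) : ℝ) ≤ A.card := by exact_mod_cast hA
    push_cast at h1
    exact_mod_cast (by linarith : (s : ℝ) ≤ A''.card))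
  have hSU : S ⊆ U := (hSA''.trans (Finset.filter_subset _ _)).trans hAU
  -- Markov 2: the vertices of `B` with `≤ 4δs` neighbours in `S` are at least `|B|/2`
  set U'' := B.filter fun b => ((S.filter fun a => Γ.Adj b a).card : ℝ) ≤ 4 * δ * s with hU''
  have hM2 : (B.card : ℝ) ≤ 2 * U''.card := by
    refine card_le_two_mul_card_filter B _ (by positivity) (fun v _ => by positivity) ?_
    have h1 : ∑ b ∈ B, ((S.filter fun a => Γ.Adj b a).card : ℝ) = (edgeCount Γ S B : ℝ) := by
      rw [edgeCount_comm, edgeCount_eq_sum]; push_cast; rfl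
    have h3 : ∑ a ∈ S, ((B.filter fun b => Γ.Adj a b).card : ℝ) ≤ ∑ a ∈ S, 2 * δ * B.card :=
      Finset.sum_le_sum fun a ha => (Finset.mem_filter.1 (hSA'' ha)).2
    rw [Finset.sum_const, nsmul_eq_mul, hScard] at h3
    rw [h1, edgeCount_eq_sum]
    push_cast
    linarith
  have hU'U : U'' \ S ⊆ U := Finset.sdiff_subset.trans ((Finset.filter_subset _ _).trans hBU)
  have hPS : Disjoint P S := hPU.mono_right hSU
  refine ⟨U'' \ S, P ∪ S, hU'U, ?_, ?_, fun u hu => ?_, ?_, ?_⟩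
  · exact Finset.disjoint_union_left.2 ⟨hPU.mono_right hU'U, Finset.disjoint_sdiff⟩
  · rw [Finset.card_union_of_disjoint hPS, hPcard, hScard]; ring
  · have h2 : ((S.filter fun b => Γ.Adj u b).card : ℝ) ≤ 4 * δ * s :=
      (Finset.mem_filter.1 (Finset.sdiff_subset hu)).2
    rw [Finset.filter_union]
    calc ((((P.filter fun b => Γ.Adj u b) ∪ (S.filter fun b => Γ.Adj u b)).card : ℕ) : ℝ)
        ≤ (((P.filter fun b => Γ.Adj u b).card + (S.filter fun b => Γ.Adj u b).card : ℕ) : ℝ) := by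
          exact_mod_cast Finset.card_union_le _ _
      _ ≤ 4 * δ * ((a + 1 : ℕ) : ℝ) * s := by push_cast; linarith [hdeg u (hU'U hu)]
  · have hSS : (edgeCount Γ S S : ℝ) ≤ (s : ℝ) * s := by
      rw [← hScard]; exact_mod_cast Rel.card_interedges_le_mul _ S S
    have hSP : (edgeCount Γ S P : ℝ) ≤ s * (4 * δ * a * s) := by
      have h := Finset.sum_le_sum fun u hu => hdeg u (hSU hu)
      rw [Finset.sum_const, nsmul_eq_mul, hScard] at h
      rw [edgeCount_eq_sum]; push_cast; exact h
    rw [edgeCount_union_left Γ hPS, edgeCount_union_right Γ P hPS, edgeCount_union_right Γ S hPS,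
      edgeCount_comm Γ P S]
    push_cast
    have h0 : (0 : ℝ) ≤ 4 * δ * s ^ 2 := by positivity
    nlinarith [hPP, hSS, hSP, h0]
  · have h2 : ((U''.card : ℕ) : ℝ) ≤ ((U'' \ S).card : ℝ) + s := by
      rw [← hScard]; exact_mod_cast Finset.card_le_card_sdiff_add_card
    linarith

/-- Exponent bookkeeping for one level: if `|U| ≥ n^t` with `t ≤ 1`, `t - 2β ≥ 7/8`, `n ≥ 16` and
`n^β ≥ 16`, then every `A` with `|A| ≥ ⌈|U|^{1-β}⌉` has `|A| ≥ 2⌈√n⌉` and `|A| > 0`, and every `U'`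
with `|U'| ≥ |A|/2 - ⌈√n⌉` has `|U'| ≥ n^{t-2β}`. -/
theorem sizes {β t : ℝ} (hβ : 0 < β) (ht1 : t ≤ 1) (ht : 7 / 8 ≤ t - 2 * β) (hn : 16 ≤ n)
    (hnβ : 16 ≤ (n : ℝ) ^ β) {U : Finset (Fin n)} (hU : (n : ℝ) ^ t ≤ U.card) {A : Finset (Fin n)}
    (hA : ⌈(U.card : ℝ) ^ (1 - β)⌉₊ ≤ A.card) :
    2 * ⌈Real.sqrt n⌉₊ ≤ A.card ∧ 0 < A.card ∧ ∀ U' : Finset (Fin n),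
      (A.card : ℝ) / 2 - ⌈Real.sqrt n⌉₊ ≤ U'.card → (n : ℝ) ^ (t - 2 * β) ≤ U'.card := by
  have hn1 : (1 : ℝ) ≤ n := by exact_mod_cast le_trans (by norm_num) hn
  have hn0 : (0 : ℝ) < n := by linarith
  -- `n^{t-2β} ≥ √n ≥ 1`
  have hsqrt : Real.sqrt n ≤ (n : ℝ) ^ (t - 2 * β) := by
    rw [Real.sqrt_eq_rpow]
    exact Real.rpow_le_rpow_of_exponent_le hn1 (by linarith)
  have h4 : (1 : ℝ) ≤ Real.sqrt n := Real.one_le_sqrt.2 hn1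
  -- `|A| ≥ |U|^{1-β} ≥ n^{t(1-β)} ≥ n^{t-β} = n^{t-2β} n^β ≥ 16 n^{t-2β}`
  have h1 : (U.card : ℝ) ^ (1 - β) ≤ A.card := (Nat.le_ceil _).trans (by exact_mod_cast hA)
  have h2 : ((n : ℝ) ^ t) ^ (1 - β) ≤ (U.card : ℝ) ^ (1 - β) :=
    Real.rpow_le_rpow (Real.rpow_nonneg hn0.le _) hU (by linarith)
  rw [← Real.rpow_mul hn0.le] at h2
  have h5 : (n : ℝ) ^ (t - β) ≤ (n : ℝ) ^ (t * (1 - β)) :=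
    Real.rpow_le_rpow_of_exponent_le hn1 (by nlinarith)
  have h6 : (n : ℝ) ^ (t - β) = (n : ℝ) ^ (t - 2 * β) * (n : ℝ) ^ β := by
    rw [← Real.rpow_add hn0]; ring_nf
  have h7 : (n : ℝ) ^ (t - 2 * β) * 16 ≤ (n : ℝ) ^ (t - 2 * β) * (n : ℝ) ^ β :=
    mul_le_mul_of_nonneg_left hnβ (Real.rpow_nonneg hn0.le _)
  have hs : (⌈Real.sqrt n⌉₊ : ℝ) < Real.sqrt n + 1 := Nat.ceil_lt_add_one (Real.sqrt_nonneg _)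
  refine ⟨?_, ?_, fun U' hU' => by linarith⟩
  · have : ((2 * ⌈Real.sqrt n⌉₊ : ℕ) : ℝ) ≤ A.card := by push_cast; linarith
    exact_mod_cast this
  · have : (0 : ℝ) < A.card := by linarith
    exact_mod_cast this

/-- **Termination.**  A union `P` of `a ≥ L ≥ 2/ε` extracted `⌈√n⌉`-sets with
`e_Γ(P,P) ≤ (a + (ε/4)a²)⌈√n⌉²` is impossible when `Γ` and `Γᶜ` are `⌈log₂ n²⌉`-clique-free and the
Erdős–Szemerédi bound (constant `ε₀ ≥ ε` at `C = 5`) is available: the induced graph `Γ.comap e_P` on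
`|P| ≥ √n ≥ n_{ES}` vertices inherits both clique-freeness conditions, `⌈log₂ n²⌉ ≤ 5 log₂ |P|`, and
`e_Γ(P,P) < ε|P|²`. -/
theorem absurd_of_family (Γ : SimpleGraph (Fin n)) [DecidableRel Γ.Adj] {ε₀ ε δ : ℝ} {nES L a s : ℕ}
    (hES : ∀ N ≥ nES, ∀ (H : SimpleGraph (Fin N)) [DecidableRel H.Adj] (k : ℕ),
      (k : ℝ) ≤ 5 * Real.logb 2 N → H.CliqueFree k → Hᶜ.CliqueFree k →
      ε₀ * N * N ≤ (edgeCount H Finset.univ Finset.univ : ℝ))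
    (hΓ : Γ.CliqueFree (Nat.clog 2 (n ^ 2))) (hΓc : Γᶜ.CliqueFree (Nat.clog 2 (n ^ 2)))
    (hn : 16 ≤ n) (hnES : nES ^ 2 ≤ n) (hs : s = ⌈Real.sqrt n⌉₊) (hε : 0 < ε) (hεle : ε ≤ ε₀)
    (hL : 2 / ε ≤ L) (hδ : δ = ε / 16) (haL : L ≤ a) {P : Finset (Fin n)} (hPcard : P.card = a * s)
    (hPP : (edgeCount Γ P P : ℝ) ≤ (a + 4 * δ * a ^ 2) * s ^ 2) : False := by
  have hn0 : (0 : ℝ) < n := by exact_mod_cast lt_of_lt_of_le (by norm_num) hn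
  have ha : (2 : ℝ) / ε ≤ a := hL.trans (by exact_mod_cast haL)
  have hεa : 2 ≤ ε * a := by rwa [div_le_iff₀ hε, mul_comm] at ha
  have ha0 : (0 : ℝ) < a := lt_of_lt_of_le (by positivity) ha
  have ha1 : 1 ≤ a := Nat.one_le_iff_ne_zero.2 (by rintro rfl; simp at ha0)
  -- `|P| ≥ s ≥ √n ≥ max 1 nES`
  have hs1 : Real.sqrt n ≤ s := by rw [hs]; exact Nat.le_ceil _
  have h4 : (1 : ℝ) ≤ Real.sqrt n := Real.one_le_sqrt.2 (by exact_mod_cast le_trans (by norm_num) hn)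
  have hN' : (s : ℝ) ≤ P.card := by exact_mod_cast hPcard ▸ Nat.le_mul_of_pos_left s ha1
  have hsnES : (nES : ℝ) ≤ s := (Real.le_sqrt_of_sq_le (by exact_mod_cast hnES)).trans hs1
  have hNnES : nES ≤ P.card := by exact_mod_cast hsnES.trans hN'
  have hs0 : (0 : ℝ) < s := by linarith
  -- the threshold: `⌈log₂ n²⌉ ≤ 2 log₂ n + 1 ≤ 5 log₂ |P|`
  have hk : ((Nat.clog 2 (n ^ 2) : ℕ) : ℝ) ≤ 5 * Real.logb 2 (P.card : ℝ) := by
    have hn2 : 1 < n ^ 2 := by nlinarith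
    have hlog : ((Nat.clog 2 (n ^ 2) - 1 : ℕ) : ℝ) < Real.logb 2 ((n : ℝ) ^ 2) := by
      rw [Real.lt_logb_iff_rpow_lt (by norm_num) (by positivity), Real.rpow_natCast]
      exact_mod_cast Nat.pow_pred_clog_lt_self (by norm_num) hn2
    rw [Real.logb_pow, Nat.cast_sub (Nat.clog_pos (by norm_num) hn2)] at hlog
    have h2 : Real.logb 2 (Real.sqrt n) ≤ Real.logb 2 (P.card : ℝ) :=
      Real.logb_le_logb_of_le (by norm_num) (by linarith) (hs1.trans hN')
    rw [Real.sqrt_eq_rpow, Real.logb_rpow_eq_mul_logb_of_pos hn0] at h2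
    have h5 : (4 : ℝ) ≤ Real.logb 2 n := by
      rw [Real.le_logb_iff_rpow_le (by norm_num) hn0]
      norm_num
      exact_mod_cast hn
    push_cast at hlog
    linarith
  -- Erdős–Szemerédi for the induced graph on `P`
  have hH : (Γ.comap (P.orderEmbOfFin rfl).toEmbedding).CliqueFree (Nat.clog 2 (n ^ 2)) :=
    hΓ.comap ⟨(SimpleGraph.Embedding.comap (P.orderEmbOfFin rfl).toEmbedding Γ).toCopy⟩
  have hHc : (Γ.comap (P.orderEmbOfFin rfl).toEmbedding)ᶜ.CliqueFree (Nat.clog 2 (n ^ 2)) :=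
    hΓc.comap ⟨(SimpleGraph.Embedding.complEquiv
      (SimpleGraph.Embedding.comap (P.orderEmbOfFin rfl).toEmbedding Γ)).toCopy⟩
  have h := hES P.card hNnES _ (Nat.clog 2 (n ^ 2)) hk hH hHc
  rw [edgeCount_comap, (map_orderEmbOfFin P Finset.univ).2] at h
  have hc : (P.card : ℝ) = a * s := by rw [hPcard]; push_cast; ring
  rw [hc] at h
  rw [hδ] at hPP
  have hmono : ε * (a * s) * (a * s) ≤ ε₀ * (a * s) * (a * s) := by
    have : (0 : ℝ) ≤ (a * s) * (a * s) := by positivity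
    nlinarith
  have key : (3 / 4 * (ε * a) - 1) * (a * (s : ℝ) ^ 2) ≤ 0 := by nlinarith [h, hPP]
  have hpos : (0 : ℝ) < a * (s : ℝ) ^ 2 := by positivity
  nlinarith [mul_le_mul_of_nonneg_right (show (1 / 2 : ℝ) ≤ 3 / 4 * (ε * a) - 1 by linarith) hpos.le]

/-- **The good case.**  A set `U` with `|U| ≥ n^{3/4}` which is two-sided bi-dense at scale
`⌈|U|^{1-β}⌉` is re-indexed as `Fin |U|` along its increasing enumeration `e`; the induced graph
`G.comap e` is lower and upper bi-dense at scale `⌈m^{1-β}⌉`, `m = |U|`. -/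
theorem core_of_good (G : SimpleGraph (Fin n)) [DecidableRel G.Adj] {β δ : ℝ} {U : Finset (Fin n)}
    (hU : (n : ℝ) ^ (3 / 4 : ℝ) ≤ U.card)
    (hgood : ∀ A ⊆ U, ∀ B ⊆ U, ⌈(U.card : ℝ) ^ (1 - β)⌉₊ ≤ A.card → ⌈(U.card : ℝ) ^ (1 - β)⌉₊ ≤ B.card →
      δ * A.card * B.card ≤ (edgeCount G A B : ℝ) ∧
        (edgeCount G A B : ℝ) ≤ (1 - δ) * A.card * B.card) :
    ∃ m : ℕ, (n : ℝ) ^ (3 / 4 : ℝ) ≤ m ∧ ∃ e : Fin m ↪ Fin n,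
      LowerBiDense (G.comap e) ⌈(m : ℝ) ^ (1 - β)⌉₊ δ ∧
        UpperBiDense (G.comap e) ⌈(m : ℝ) ^ (1 - β)⌉₊ δ := by
  have h : ∀ A B : Finset (Fin U.card), ⌈(U.card : ℝ) ^ (1 - β)⌉₊ ≤ A.card →
      ⌈(U.card : ℝ) ^ (1 - β)⌉₊ ≤ B.card →
      δ * A.card * B.card ≤ (edgeCount (G.comap (U.orderEmbOfFin rfl).toEmbedding) A B : ℝ) ∧
        (edgeCount (G.comap (U.orderEmbOfFin rfl).toEmbedding) A B : ℝ) ≤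
          (1 - δ) * A.card * B.card := by
    intro A B hA hB
    rw [edgeCount_comap]
    have h := hgood _ (map_orderEmbOfFin U A).1 _ (map_orderEmbOfFin U B).1
      (by rwa [Finset.card_map]) (by rwa [Finset.card_map])
    rwa [Finset.card_map, Finset.card_map] at h
  exact ⟨U.card, hU, (U.orderEmbOfFin rfl).toEmbedding, fun A B hA hB => (h A B hA hB).1,
    fun A B hA hB => (h A B hA hB).2⟩

/-- **The recursion**, as an induction on the level `i ≤ 2L`: either a good set `U` with
`|U| ≥ n^{3/4}` has been found, or there is a state `(U, P, Q, a, b)` at level `i` (`a + b = i`,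
`|U| ≥ n^{1-2iβ}`, `P`/`Q` the unions of the sparse/dense extracted `s`-sets with their degree and
pair-count invariants). -/
theorem iterate (G : SimpleGraph (Fin n)) [DecidableRel G.Adj] {β δ : ℝ} {L s : ℕ} (hδ : 0 < δ)
    (hβ : β = 1 / (32 * L)) (hL : 1 ≤ L) (hn : 16 ≤ n) (hnβ : 16 ≤ (n : ℝ) ^ β)
    (hs : s = ⌈Real.sqrt n⌉₊) (i : ℕ) (hi : i ≤ 2 * L) :
    (∃ U : Finset (Fin n), (n : ℝ) ^ (3 / 4 : ℝ) ≤ U.card ∧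
      ∀ A ⊆ U, ∀ B ⊆ U, ⌈(U.card : ℝ) ^ (1 - β)⌉₊ ≤ A.card → ⌈(U.card : ℝ) ^ (1 - β)⌉₊ ≤ B.card →
        δ * A.card * B.card ≤ (edgeCount G A B : ℝ) ∧
          (edgeCount G A B : ℝ) ≤ (1 - δ) * A.card * B.card) ∨
    ∃ U P Q : Finset (Fin n), ∃ a b : ℕ, a + b = i ∧ Disjoint P U ∧ Disjoint Q U ∧
      P.card = a * s ∧ Q.card = b * s ∧
      (∀ u ∈ U, ((P.filter fun v => G.Adj u v).card : ℝ) ≤ 4 * δ * a * s) ∧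
      (∀ u ∈ U, ((Q.filter fun v => Gᶜ.Adj u v).card : ℝ) ≤ 4 * δ * b * s) ∧
      (edgeCount G P P : ℝ) ≤ (a + 4 * δ * a ^ 2) * s ^ 2 ∧
      (edgeCount Gᶜ Q Q : ℝ) ≤ (b + 4 * δ * b ^ 2) * s ^ 2 ∧
      (n : ℝ) ^ (1 - 2 * (i : ℝ) * β) ≤ U.card := by
  have hn1 : (1 : ℝ) ≤ n := by exact_mod_cast le_trans (by norm_num) hn
  have hL' : (1 : ℝ) ≤ L := by exact_mod_cast hL
  have hβpos : 0 < β := by rw [hβ]; positivity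
  have hLβ : (L : ℝ) * β = 1 / 32 := by rw [hβ]; field_simp
  have hs0 : 0 < s := hs ▸ Nat.ceil_pos.2 (Real.sqrt_pos.2 (by linarith))
  induction i with
  | zero =>
    refine Or.inr ⟨Finset.univ, ∅, ∅, 0, 0, rfl, Finset.disjoint_empty_left _,
      Finset.disjoint_empty_left _, by simp, by simp, fun u _ => by simp, fun u _ => by simp,
      by simp [edgeCount], by simp [edgeCount], by simp⟩
  | succ i ih =>
    rcases ih (by omega) with h | ⟨U, P, Q, a, b, hab, hPU, hQU, hPc, hQc, hdP, hdQ, hPP, hQQ, hU⟩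
    · exact Or.inl h
    have hi' : (i : ℝ) + 1 ≤ 2 * L := by exact_mod_cast (by omega : i + 1 ≤ 2 * L)
    have ht1 : 1 - 2 * (i : ℝ) * β ≤ 1 := by nlinarith [hβpos, (Nat.cast_nonneg i : (0 : ℝ) ≤ i)]
    have ht : 7 / 8 ≤ 1 - 2 * (i : ℝ) * β - 2 * β := by
      nlinarith [mul_le_mul_of_nonneg_right hi' hβpos.le]
    have hexp : (1 - 2 * ((i + 1 : ℕ) : ℝ) * β) = 1 - 2 * (i : ℝ) * β - 2 * β := by push_cast; ring
    by_cases hgood : ∀ A ⊆ U, ∀ B ⊆ U, ⌈(U.card : ℝ) ^ (1 - β)⌉₊ ≤ A.card →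
        ⌈(U.card : ℝ) ^ (1 - β)⌉₊ ≤ B.card →
        δ * A.card * B.card ≤ (edgeCount G A B : ℝ) ∧
          (edgeCount G A B : ℝ) ≤ (1 - δ) * A.card * B.card
    · exact Or.inl ⟨U, (Real.rpow_le_rpow_of_exponent_le hn1 (by linarith)).trans hU, hgood⟩
    push Not at hgood
    obtain ⟨A, hAU, B, hBU, hA, hB, hbad⟩ := hgood
    obtain ⟨hA2, -, -⟩ := sizes hβpos ht1 ht hn hnβ hU hA
    obtain ⟨-, hBpos, hB3⟩ := sizes hβpos ht1 ht hn hnβ hU hB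
    rw [← hs] at hA2 hB3
    rw [hexp]
    right
    by_cases hsparse : (edgeCount G A B : ℝ) < δ * A.card * B.card
    · obtain ⟨U', P', hU'U, hP'U', hP'c, hdP', hP'P', hU'c⟩ :=
        step G hδ hs0 hPU hPc hdP hPP hAU hBU hA2 hBpos hsparse
      exact ⟨U', P', Q, a + 1, b, by omega, hP'U', hQU.mono_right hU'U, hP'c, hQc, hdP',
        fun u hu => hdQ u (hU'U hu), hP'P', hQQ, hB3 U' hU'c⟩
    · have hc : (edgeCount G A B : ℝ) + (edgeCount Gᶜ A B : ℝ) ≤ A.card * B.card := by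
        exact_mod_cast edgeCount_add_compl_le G A B
      have hbad' : (edgeCount Gᶜ A B : ℝ) < δ * A.card * B.card := by
        linarith [hbad (not_lt.1 hsparse)]
      obtain ⟨U', Q', hU'U, hQ'U', hQ'c, hdQ', hQ'Q', hU'c⟩ :=
        step Gᶜ hδ hs0 hQU hQc hdQ hQQ hAU hBU hA2 hBpos hbad'
      exact ⟨U', P, Q', a, b + 1, by omega, hPU.mono_right hU'U, hQ'U', hPc, hQ'c,
        fun u hu => hdP u (hU'U hu), hdQ', hPP, hQ'Q', hB3 U' hU'c⟩

end BiDenseCore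

open BiDenseCore in
/-- **Prömel–Rödl bi-dense core from Erdős–Szemerédi** (registered stub `stub_ramseyBiDenseCore`,
line `sound-path-bottleneck`, crux stmt-PneNP-9818; Prömel–Rödl 1999, JCTA 88, 379–384 = LPRT
arXiv:1303.3166 Lemma 11, via Kwan–Sudakov arXiv:1711.02937 Lemma 4): if for every `C > 0` some
`ε > 0` makes every large graph with neither clique nor independent set of size `k ≤ C log₂ n` have
`≥ ε n²` ordered edges, then there are `β, δ ∈ (0,1)` and `n₀` such that every graph `G` on `n ≥ n₀`
vertices with `G` and `Gᶜ` both `⌈log₂ n²⌉`-clique-free has an induced subgraph `G.comap e` on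
`m ≥ n^{3/4}` vertices which is lower and upper bi-dense with density `δ` at scale `⌈m^{1-β}⌉`. -/
theorem stub_ramseyBiDenseCore :
    (∀ C : ℝ, 0 < C → ∃ ε : ℝ, 0 < ε ∧ ∃ n₀ : ℕ, ∀ n ≥ n₀,
      ∀ (G : SimpleGraph (Fin n)) [DecidableRel G.Adj] (k : ℕ), (k : ℝ) ≤ C * Real.logb 2 n →
        G.CliqueFree k → Gᶜ.CliqueFree k → ε * n * n ≤ (edgeCount G Finset.univ Finset.univ : ℝ)) →
    ∃ β : ℝ, 0 < β ∧ β < 1 ∧ ∃ δ : ℝ, 0 < δ ∧ δ < 1 ∧ ∃ n₀ : ℕ, ∀ n ≥ n₀,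
      ∀ (G : SimpleGraph (Fin n)) [DecidableRel G.Adj],
        G.CliqueFree (Nat.clog 2 (n ^ 2)) → Gᶜ.CliqueFree (Nat.clog 2 (n ^ 2)) →
        ∃ m : ℕ, (n : ℝ) ^ (3 / 4 : ℝ) ≤ m ∧ ∃ e : Fin m ↪ Fin n,
          LowerBiDense (G.comap e) ⌈(m : ℝ) ^ (1 - β)⌉₊ δ ∧ UpperBiDense (G.comap e) ⌈(m : ℝ) ^ (1 - β)⌉₊ δ := by
  intro hES
  obtain ⟨ε₀, hε₀, nES, hES⟩ := hES 5 (by norm_num)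
  -- constants `ε = min ε₀ 1`, `L = ⌈2/ε⌉`, `β = 1/(32L)`, `δ = ε/16`
  obtain ⟨ε, hεpos, hε1, hεle⟩ : ∃ ε : ℝ, 0 < ε ∧ ε ≤ 1 ∧ ε ≤ ε₀ :=
    ⟨min ε₀ 1, lt_min hε₀ one_pos, min_le_right _ _, min_le_left _ _⟩
  have hL2 : (2 : ℝ) / ε ≤ ⌈(2 : ℝ) / ε⌉₊ := Nat.le_ceil _
  have hL1 : 1 ≤ ⌈(2 : ℝ) / ε⌉₊ := by
    have h2 : (2 : ℝ) ≤ 2 / ε := by rw [le_div_iff₀ hεpos]; linarith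
    exact_mod_cast (by linarith : (1 : ℝ) ≤ ⌈(2 : ℝ) / ε⌉₊)
  have hL' : (1 : ℝ) ≤ ⌈(2 : ℝ) / ε⌉₊ := by exact_mod_cast hL1
  have hβpos : (0 : ℝ) < 1 / (32 * ⌈(2 : ℝ) / ε⌉₊) := by positivity
  -- threshold for `n^β ≥ 16`
  obtain ⟨Nβ, hNβ⟩ : ∃ N : ℕ, ∀ n ≥ N, (16 : ℝ) ≤ (n : ℝ) ^ (1 / (32 * ⌈(2 : ℝ) / ε⌉₊) : ℝ) :=
    Filter.eventually_atTop.1 (tendsto_natCast_atTop_atTop.eventually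
      ((tendsto_rpow_atTop hβpos).eventually_ge_atTop 16))
  refine ⟨1 / (32 * ⌈(2 : ℝ) / ε⌉₊), hβpos, by rw [div_lt_one (by positivity)]; linarith, ε / 16,
    by positivity, by linarith, max 16 (max (nES ^ 2) Nβ), ?_⟩
  intro n hn G _ hG hGc
  simp only [ge_iff_le, max_le_iff] at hn
  obtain ⟨hn16, hnES, hnNβ⟩ := hn
  rcases iterate G (δ := ε / 16) (by positivity) rfl hL1 hn16 (hNβ n hnNβ) rfl (2 * ⌈(2 : ℝ) / ε⌉₊)
    le_rfl with
    ⟨U, hU, hgood⟩ | ⟨U, P, Q, a, b, hab, -, -, hPc, hQc, -, -, hPP, hQQ, -⟩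
  · exact core_of_good G hU hgood
  · exfalso
    rcases (by omega : ⌈(2 : ℝ) / ε⌉₊ ≤ a ∨ ⌈(2 : ℝ) / ε⌉₊ ≤ b) with ha | hb
    · exact absurd_of_family G hES hG hGc hn16 hnES rfl hεpos hεle hL2 rfl ha hPc hPP
    · exact absurd_of_family Gᶜ hES hGc (by rwa [compl_compl]) hn16 hnES rfl hεpos hεle hL2 rfl hb
        hQc hQQ

end Summit.PneNP.PneNP.Cruxes.RegularResolutionRung.SoundPathBottleneck
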